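import Summits.QuantumFields.YangMills.Theorems.UnitScaleTiltProp7BlockConvolutionWeightedSup
import Summits.QuantumFields.YangMills.Theorems.UnitScaleTiltProp7ComplementaryProjectorBlockSup
import Summits.QuantumFields.YangMills.Theorems.UnitScaleTiltProp7PoissonGradientDecay
import Summits.QuantumFields.YangMills.Theorems.UnitScaleTiltProp7ZeroModesOrthKerTopMean
import Summits.QuantumFields.YangMills.Theorems.UnitScaleTiltProp7RieszTauFrobNormT3
import HarnessLib

/-!
# Route `UnitScaleTilt`, crux K1 «MinimiserStabilityRegPr» (stmt-QuantumFields-19200), EX row `norm_G`, N6 FILE D — **(W4) THE BLOCK∕WEIGHTED (c)-PACKAGE KNIT: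
# THE THREE GAUGE-RESTORING WORDS `G′ᴾR_S`, `D_{U₀}G′ᴾR_S`, `R_SG′ᴾ` ON A SOURCE DECAYING FROM (OR SUPPORTED IN) A BLOCK `z` DECAY FROM `z` AT THE SAME RATE** —
# ★p1 g27's D3 letters **(c1b)(c2b)(c3b)** (`hGblk_pi_of_blockLetters`) and D2 letters (c1w)(c2w)(c3w) (`blockDecay_rows_GTpi_of_letters`) BY TEXT, from three displayed
# weighted operator letters — VAL-κ `hGw` (⟸ (W1) ✓`hGsupW_of_regPr`), P-κ `hPw` (⟸ §3 here ∘ (W2) ∘ V5b), T1-κ `hDw` (⟸ §3 here ∘ px21 ✓`gradient_decay_of_decay` ∘ (W1)) —,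
# (Z0) ✓`GprimeP_RS_eq_G_RS`∕✓`RS_GprimeP_eq_RS_G` (`G′ᴾR_S = G_aR_S`, `R_SG′ᴾ = R_SG_a`: no `P₀`) and `R_S = 1 − P` under Lift (CHAIR WORDS №30 (2) ∕ №31; width seat `ym3-torus-px5` gen 14).

Cell `ym3-torus` (HUMAN RULING D-0037; rung R3 = SU(2) YM₃ on T³ — NOT d = 4, NOT infinite volume, NOT a mass gap, NOT Clay).  THEOREMS ONLY (0 `def`, 0 `sorry`, default heartbeats);
`--supports stmt-QuantumFields-19200 --as helper`; count-neutral.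

THE MATHEMATICS ([Balaban1985BackgroundPropagators] (3.21)–(3.25), Thm 3.1 (3.42)∕(3.46), (3.49): the words of (3.118)–(3.122) inherit the block decay of `G_a` and `R`).  With
`E_z(x) := e^{−κ·tdist(B x, z)}` and the three RATE-PRESERVING letters `|G_a f| ≤ B_w|f|_{E}E_z`, `|(1 − R)f| ≤ P_w|f|_{E}E_z`, `|D_{U₀}G_a f|(b) ≤ R_w|f|_{E}E_z(b₋)`:
`R_S g = g − (1 − R)g` ⟹ `|R_S g| ≤ (1 + P_w)|g|_E E_z`; `G′ᴾR_S = G_aR_S` ⟹ (c1) `B_w(1 + P_w)`; `DG′ᴾR_S = DG_aR_S` ⟹ (c2) `R_w(1 + P_w)`; `R_SG′ᴾ = R_SG_a` ⟹ (c3) `B_w(1 + P_w)`.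
The route reads `toL2S v` with `‖(toL2S v)(y)‖_{W₂} ≤ √2‖v y‖` (✓`norm_frobEquiv_symm_le`) and `‖(toL2S⁻¹u)(y)‖ ≤ ‖u(y)‖_{W₂}` (✓`norm_frobEquiv_le`); a source SUPPORTED in `B(z)` with
`‖v y‖ ≤ m` is a weighted one (`tdist(z, z) = 0`), so the BLOCK editions (c·b) are the weighted ones (c·w) read on such sources.

WHAT IS PROVED (ns `Summit.QuantumFields.YangMills.Theorems.Prop7GaugeProjectorBlockPackage`; LOD∕Lift letters `Q″ hseq ι T hT G hAG hGA hRS hker` VERBATIM as in (Z0) ∕ ✓p769224;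
`G′ᴾ`'s parameter `0 ≤ a′` free of the LOD mass `a`; rate `κ ≥ 0`; displayed letters `hGw hPw hDw` with constants `B_w P_w R_w`).
* §1 (fibre currency `WL2.equiv … (siteEquiv x)`): ★`norm_equiv_RS_le_of_weighted` (`1 + P_w`), ★`norm_equiv_GprimeP_RS_le_of_weighted` (c1: `B_w(1+P_w)`),
  ★`norm_equiv_DL2_GprimeP_RS_le_of_weighted` (c2: `R_w(1+P_w)`), ★`norm_equiv_RS_GprimeP_le_of_weighted` (c3: `B_w(1+P_w)`).
* §2 (route currency): `norm_equiv_toL2S_le_of_weighted` (`√2`), `weighted_of_blockSupported_source`; ★★★ **`hc1w_of_letters`∕`hc2w_of_letters`∕`hc3w_of_letters`** = D2's (c·w) texts with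
  `C₁ = C₃ = √2·B_w(1+P_w)`, `C₂ = √2·R_w(1+P_w)`; ★★★ **`hc1b_of_letters`∕`hc2b_of_letters`∕`hc3b_of_letters`** = D3's (c·b) texts VERBATIM (`m * Cᵢ * e^{−δ₁·tdist}`, `δ₁ := κ`).
* §3 suppliers: ★★ `hPw_of_spikeKernel` — `hPw` at every `0 ≤ κ < μ′` from V5b's spike kernel letter DISPLAYED (`hPker`, inhabited by ✓`norm_equiv_sub_projR_single_le_closed`) via (W2) §1 and
  (W1) §2, `P_w = C_P·(L^d)^{K−n}·(2(1+1∕(μ′−κ)))³`; ★★ `hDw_of_letters` — `hDw` from `hGw` and the penalty letter `hpen` (⟸ (W1) ✓`hpenW_of_regPr`) via px21 ✓`gradient_decay_of_decay` at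
  `u := G_a f`, `q := a·TιQ″(G_a f) − f`, `R_w = 2·(C_g·(B_w e^{51κ}c(ε₀) + (P_pen+1)e^{51κ}) + 2√2·48ε₀·B_w e^{51κ})`.
HYP-SAT (★★OWNER RULING №42).  LOD∕Lift letters: inhabited as in ✓p769224 (`hseq hT hAG hGA` ⟸ ✓`exists_intertwiner_of_regPr`∕✓`exists_massive_inverse`; `hRS hker` ⟸ ✓`RS_eq_projR_of_lift`
under the Lift antecedent).  `hGw` ⟸ (W1) ✓`hGsupW_of_regPr` (`κ < (min μ ¼)∕2`); `hPw` ⟸ §3 (`κ < μ′`); `hDw` ⟸ §3 + `hroom`∕`hsmall` (CHAIR WORD №1 class); all real-inequality schemas with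
K-free constants at the pin; conclusions are explicit decayed rows — non-vacuous, no `Prop` placeholder.
HONEST SCOPE.  Algebra + readings over landed letters; nothing of D1–D3's bootstrap, `norm_G`, the ten EX rows, EX `stub_existenceMinimalOrbit`, the crux or the rung is proved
here; the Yang–Mills mass gap is NOT proved.

References: T. Bałaban, CMP **99** (1985) 389–434 [Balaban1985BackgroundPropagators] ((3.21)–(3.25) p.394, Thm 3.1 (3.42)∕(3.46) pp.397–398, (3.49) p.399, (3.118)–(3.122)
pp.419–420); CMP **102** (1985) 277–309 [Balaban1985Variational] ((138)–(139) p.299).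
-/

set_option autoImplicit false

noncomputable section

open scoped BigOperators Matrix.Norms.L2Operator InnerProductSpace ComplexConjugate Matrix

namespace Summit.QuantumFields.YangMills.Theorems.Prop7GaugeProjectorBlockPackage

open Literature.MathematicalPhysics.QuantumFieldTheory.Balaban1983to89
open Literature.MathematicalPhysics.QuantumFieldTheory.Balaban1983to89.T3ContinuumYM3Torus
open T4Continuum BlockAveraging
open BlockAveraging (Idx off)
open B7Prop1Explicit (disp)
open B5Eq118OneStroke (iterBlockOf)
open B10Eq27TorusAxialLog (holT transl)
open B7TransferAnalyticMean (meanCLM)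
open B4Sect5Torus (TSite)
open B9SectCLatticeCarrier (Bond)
open B9Eq311L2Pairing (WL2)
open B11Eq103H1Complex (SiteL2K BondL2K projR)
open Summit.QuantumFields.YangMills.Theorems.Prop8Chart (emlIterU)
open T3SectALandauChart (eta bgUnits)
open T3PrintedRegularMinimiser (RegPr)
open Summit.QuantumFields.YangMills.Theorems.Prop7SectET3Transport (periodsT3 siteEquiv bondEquiv)
open Summit.QuantumFields.YangMills.Theorems.Prop7SectET3HilbertLetters (W₂ frobEquiv toL2 toL2S DL2 DstarL2 covLapSite toL2S_apply toL2S_symm_apply toL2_symm_apply)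
open Summit.QuantumFields.YangMills.Theorems.Prop7RieszTauFrobNorm (norm_frobEquiv_symm_le norm_frobEquiv_le)
open Summit.QuantumFields.YangMills.Theorems.Prop7SectET3GaugeProjector (NS RS)
open Summit.QuantumFields.YangMills.Theorems.Prop7SectET3DeltaPiPInv (GprimeP)
open Summit.QuantumFields.YangMills.Theorems.Prop7ZeroModesOrthKerTopMean (GprimeP_RS_eq_G_RS RS_GprimeP_eq_RS_G)
open Summit.QuantumFields.YangMills.Theorems.Prop7BlockConvolutionWeightedSup (norm_equiv_apply_le_of_blockLetter)
open Summit.QuantumFields.YangMills.Theorems.Prop7ComplementaryProjectorBlockSup (blockLetter_of_spikeKernel)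
open Summit.QuantumFields.YangMills.Theorems.Prop7PoissonGradientDecay (gradient_decay_of_decay)
open Summit.QuantumFields.YangMills.Theorems.Prop7CurvedMemberLocalGradient (exists_curved_localGradient)
open Summit.QuantumFields.YangMills.Theorems.AxialGaugeChartGlue (norm_bgOfCfg_axialT_sub_le)

variable (F : T3Family) {n K : ℕ} (h : n ≤ K) {c₀ c₁ cB : ℝ} [Fact (0 < c₀)] [Fact (0 < c₁)] [Fact (0 < cB)]
  (U₀ : GaugeField (F.P K) 0 (Matrix.specialUnitaryGroup (Fin 2) ℂ))
  (Q'' : SiteL2K ℂ 3 (periodsT3 F K) c₀ W₂ →ₗ[ℂ] (Site (F.P K) (K - n) → Matrix (Fin 2) (Fin 2) ℂ))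
  (hseq : ∀ lam : Site (F.P K) 0 → Matrix (Fin 2) (Fin 2) ℂ, ∃ ns : (j : ℕ) → Site (F.P K) j → Matrix (Fin 2) (Fin 2) ℂ, ns 0 = lam ∧
      (∀ (j : ℕ) (y : Site (F.P K) (j + 1)), ns (j + 1) y = ns j (emb y) - meanCLM (Idx (F.P K)) (Matrix (Fin 2) (Fin 2) ℂ) fun i : Idx (F.P K) =>
        ns j (emb y) - ((holT (emlIterU j (bgUnits F K U₀)) (emb y) (stairWord i.2.1 (off i.1)) : (Matrix (Fin 2) (Fin 2) ℂ)ˣ) : Matrix (Fin 2) (Fin 2) ℂ) *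
          ns j (transl (emb y) (disp (stairWord i.2.1 (off i.1)))) * (((holT (emlIterU j (bgUnits F K U₀)) (emb y) (stairWord i.2.1 (off i.1)))⁻¹ : (Matrix (Fin 2) (Fin 2) ℂ)ˣ) : Matrix (Fin 2) (Fin 2) ℂ)) ∧
      ns (K - n) = Q'' (toL2S F K c₀ lam))
  (ι : (Site (F.P K) (K - n) → Matrix (Fin 2) (Fin 2) ℂ) →ₗ[ℂ] SiteL2K ℂ 3 (periodsT3 F n) c₁ W₂)
  (T : SiteL2K ℂ 3 (periodsT3 F n) c₁ W₂ →ₗ[ℂ] SiteL2K ℂ 3 (periodsT3 F K) c₀ W₂)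
  (hT : ∀ (l : SiteL2K ℂ 3 (periodsT3 F K) c₀ W₂) (f : SiteL2K ℂ 3 (periodsT3 F n) c₁ W₂), ⟪ι (Q'' l), f⟫_ℂ = ⟪l, T f⟫_ℂ)
  {a : ℝ}
  (G : SiteL2K ℂ 3 (periodsT3 F K) c₀ W₂ →ₗ[ℂ] SiteL2K ℂ 3 (periodsT3 F K) c₀ W₂)
  (hAG : ∀ f, covLapSite F n K c₀ U₀ (G f) + (a : ℂ) • T (ι (Q'' (G f))) = f)
  (hGA : ∀ u, G (covLapSite F n K c₀ U₀ u + (a : ℂ) • T (ι (Q'' u))) = u)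
  (hRS : RS F n K h c₀ cB U₀ = projR (covLapSite F n K c₀ U₀) Q'')
  (hker : LinearMap.ker Q'' ≤ NS F n K h c₀ cB U₀)
  {κ Bw Pw Rw : ℝ}
  (hGw : ∀ (f : SiteL2K ℂ 3 (periodsT3 F K) c₀ W₂) (z : Site (F.P K) (K - n)) (Fb : ℝ),
    (∀ x : Site (F.P K) 0, ‖WL2.equiv ℂ _ W₂ f (siteEquiv F K x)‖ ≤ Fb * Real.exp (-(κ * (Site.tdist (P := F.P K) (iterBlockOf (K - n) x) z : ℝ)))) →
    ∀ x : Site (F.P K) 0, ‖WL2.equiv ℂ _ W₂ (G f) (siteEquiv F K x)‖ ≤ Bw * Fb * Real.exp (-(κ * (Site.tdist (P := F.P K) (iterBlockOf (K - n) x) z : ℝ))))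
  (hPw : ∀ (f : SiteL2K ℂ 3 (periodsT3 F K) c₀ W₂) (z : Site (F.P K) (K - n)) (Fb : ℝ),
    (∀ x : Site (F.P K) 0, ‖WL2.equiv ℂ _ W₂ f (siteEquiv F K x)‖ ≤ Fb * Real.exp (-(κ * (Site.tdist (P := F.P K) (iterBlockOf (K - n) x) z : ℝ)))) →
    ∀ x : Site (F.P K) 0, ‖WL2.equiv ℂ _ W₂ ((LinearMap.id - projR (covLapSite F n K c₀ U₀) Q'' : SiteL2K ℂ 3 (periodsT3 F K) c₀ W₂ →ₗ[ℂ] SiteL2K ℂ 3 (periodsT3 F K) c₀ W₂) f) (siteEquiv F K x)‖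
      ≤ Pw * Fb * Real.exp (-(κ * (Site.tdist (P := F.P K) (iterBlockOf (K - n) x) z : ℝ))))
  (hDw : ∀ (f : SiteL2K ℂ 3 (periodsT3 F K) c₀ W₂) (z : Site (F.P K) (K - n)) (Fb : ℝ),
    (∀ x : Site (F.P K) 0, ‖WL2.equiv ℂ _ W₂ f (siteEquiv F K x)‖ ≤ Fb * Real.exp (-(κ * (Site.tdist (P := F.P K) (iterBlockOf (K - n) x) z : ℝ)))) →
    ∀ b : PBond (F.P K) 0, ‖WL2.equiv ℂ _ W₂ (DL2 F n K c₀ U₀ (G f)) (bondEquiv F K b)‖ ≤ Rw * Fb * Real.exp (-(κ * (Site.tdist (P := F.P K) (iterBlockOf (K - n) b.src) z : ℝ))))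

/-! ## §1 The knit in the fibre currency -/

include hRS hPw in
omit [Fact (0 < c₁)] [Fact (0 < cB)] in
/-- ★ **`R_S` PRESERVES A BLOCK-DISTANCE WEIGHT, `1 + P_w`**: under Lift `R_S = R = g ↦ g − (1 − R)g`, so `‖(R_S g)(x)‖ ≤ (1 + P_w)·G_b·E_z(x)` from the P-letter.
[cite: Balaban1985BackgroundPropagators, (3.21) p.394, (3.49) p.399] -/
theorem norm_equiv_RS_le_of_weighted (g : SiteL2K ℂ 3 (periodsT3 F K) c₀ W₂) (z : Site (F.P K) (K - n)) (Gb : ℝ)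
    (hg : ∀ x : Site (F.P K) 0, ‖WL2.equiv ℂ _ W₂ g (siteEquiv F K x)‖ ≤ Gb * Real.exp (-(κ * (Site.tdist (P := F.P K) (iterBlockOf (K - n) x) z : ℝ)))) :
    ∀ x : Site (F.P K) 0, ‖WL2.equiv ℂ _ W₂ (RS F n K h c₀ cB U₀ g) (siteEquiv F K x)‖
      ≤ (1 + Pw) * Gb * Real.exp (-(κ * (Site.tdist (P := F.P K) (iterBlockOf (K - n) x) z : ℝ))) := by
  intro x
  have hP := hPw g z Gb hg x
  rw [LinearMap.sub_apply, LinearMap.id_apply] at hP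
  have hRSg : RS F n K h c₀ cB U₀ g = g - (g - projR (covLapSite F n K c₀ U₀) Q'' g) := by rw [hRS, sub_sub_cancel]
  rw [hRSg, WL2.equiv_sub, Pi.sub_apply]
  calc _ ≤ Gb * Real.exp (-(κ * (Site.tdist (P := F.P K) (iterBlockOf (K - n) x) z : ℝ)))
        + Pw * Gb * Real.exp (-(κ * (Site.tdist (P := F.P K) (iterBlockOf (K - n) x) z : ℝ))) := (norm_sub_le _ _).trans (add_le_add (hg x) hP)
    _ = _ := by ring

include hseq hGA hRS hker hGw hPw in
omit [Fact (0 < c₁)] in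
/-- ★ **(c1) IN THE FIBRE CURRENCY — `‖(G′ᴾ_{a′}R_S g)(x)‖ ≤ B_w(1 + P_w)·G_b·E_z(x)`**: (Z0) ✓`GprimeP_RS_eq_G_RS` (`G′ᴾR_S = G_aR_S`), the VALUE letter `hGw` on `R_S g`.
[cite: Balaban1985BackgroundPropagators, (3.25) p.394, Thm 3.1 (3.42)∕(3.46) pp.397–398, (3.118)–(3.122) pp.419–420] -/
theorem norm_equiv_GprimeP_RS_le_of_weighted {a' : ℝ} (ha' : 0 ≤ a') (g : SiteL2K ℂ 3 (periodsT3 F K) c₀ W₂) (z : Site (F.P K) (K - n)) (Gb : ℝ)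
    (hg : ∀ x : Site (F.P K) 0, ‖WL2.equiv ℂ _ W₂ g (siteEquiv F K x)‖ ≤ Gb * Real.exp (-(κ * (Site.tdist (P := F.P K) (iterBlockOf (K - n) x) z : ℝ)))) :
    ∀ x : Site (F.P K) 0, ‖WL2.equiv ℂ _ W₂ (GprimeP F n K h c₀ cB a' U₀ (RS F n K h c₀ cB U₀ g)) (siteEquiv F K x)‖
      ≤ Bw * (1 + Pw) * Gb * Real.exp (-(κ * (Site.tdist (P := F.P K) (iterBlockOf (K - n) x) z : ℝ))) := by
  intro x
  rw [GprimeP_RS_eq_G_RS F h U₀ Q'' hseq ι T G hGA hRS hker ha' g]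
  exact (hGw _ z _ (norm_equiv_RS_le_of_weighted F h U₀ Q'' hRS hPw g z Gb hg) x).trans (le_of_eq (by ring))

include hseq hGA hRS hker hPw hDw in
omit [Fact (0 < c₁)] in
/-- ★ **(c2) IN THE FIBRE CURRENCY — `‖(D_{U₀}G′ᴾ_{a′}R_S g)(b)‖ ≤ R_w(1 + P_w)·G_b·E_z(b₋)`**: (Z0), the GRADIENT letter `hDw` on `R_S g`.
[cite: Balaban1985BackgroundPropagators, (3.25) p.394, Thm 3.1 (3.42) p.397; Balaban1985Variational, (139) p.299] -/
theorem norm_equiv_DL2_GprimeP_RS_le_of_weighted {a' : ℝ} (ha' : 0 ≤ a') (g : SiteL2K ℂ 3 (periodsT3 F K) c₀ W₂) (z : Site (F.P K) (K - n)) (Gb : ℝ)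
    (hg : ∀ x : Site (F.P K) 0, ‖WL2.equiv ℂ _ W₂ g (siteEquiv F K x)‖ ≤ Gb * Real.exp (-(κ * (Site.tdist (P := F.P K) (iterBlockOf (K - n) x) z : ℝ)))) :
    ∀ b : PBond (F.P K) 0, ‖WL2.equiv ℂ _ W₂ (DL2 F n K c₀ U₀ (GprimeP F n K h c₀ cB a' U₀ (RS F n K h c₀ cB U₀ g))) (bondEquiv F K b)‖
      ≤ Rw * (1 + Pw) * Gb * Real.exp (-(κ * (Site.tdist (P := F.P K) (iterBlockOf (K - n) b.src) z : ℝ))) := by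
  intro b
  rw [GprimeP_RS_eq_G_RS F h U₀ Q'' hseq ι T G hGA hRS hker ha' g]
  exact (hDw _ z _ (norm_equiv_RS_le_of_weighted F h U₀ Q'' hRS hPw g z Gb hg) b).trans (le_of_eq (by ring))

include hseq hT hAG hGA hRS hker hGw hPw in
/-- ★ **(c3) IN THE FIBRE CURRENCY — `‖(R_SG′ᴾ_{a′} g)(x)‖ ≤ B_w(1 + P_w)·G_b·E_z(x)`**: (Z0) ✓`RS_GprimeP_eq_RS_G` (`R_SG′ᴾ = R_SG_a`), the VALUE letter, then `R_S`.
[cite: Balaban1985BackgroundPropagators, (3.21)–(3.25) p.394, Thm 3.1 (3.42)∕(3.46) pp.397–398] -/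
theorem norm_equiv_RS_GprimeP_le_of_weighted {a' : ℝ} (ha' : 0 ≤ a') (g : SiteL2K ℂ 3 (periodsT3 F K) c₀ W₂) (z : Site (F.P K) (K - n)) (Gb : ℝ)
    (hg : ∀ x : Site (F.P K) 0, ‖WL2.equiv ℂ _ W₂ g (siteEquiv F K x)‖ ≤ Gb * Real.exp (-(κ * (Site.tdist (P := F.P K) (iterBlockOf (K - n) x) z : ℝ)))) :
    ∀ x : Site (F.P K) 0, ‖WL2.equiv ℂ _ W₂ (RS F n K h c₀ cB U₀ (GprimeP F n K h c₀ cB a' U₀ g)) (siteEquiv F K x)‖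
      ≤ Bw * (1 + Pw) * Gb * Real.exp (-(κ * (Site.tdist (P := F.P K) (iterBlockOf (K - n) x) z : ℝ))) := by
  intro x
  rw [RS_GprimeP_eq_RS_G F h U₀ Q'' hseq ι T hT G hAG hGA hRS hker ha' g]
  exact (norm_equiv_RS_le_of_weighted F h U₀ Q'' hRS hPw (G g) z (Bw * Gb) (hGw g z Gb hg) x).trans (le_of_eq (by ring))

/-! ## §2 The route currency: weighted sources (c·w) and block-supported sources (c·b) -/

omit [Fact (0 < c₀)] [Fact (0 < c₁)] [Fact (0 < cB)] in
/-- The route's source reading: `‖v y‖ ≤ m·E_z(y)` ⟹ `‖(toL2S v)(y)‖_{W₂} ≤ √2·m·E_z(y)` (✓`norm_frobEquiv_symm_le`). [cite: Balaban1985Averaging, (18)–(20) p.21] -/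
theorem norm_equiv_toL2S_le_of_weighted (v : Site (F.P K) 0 → Matrix (Fin 2) (Fin 2) ℂ) (z : Site (F.P K) (K - n)) (m : ℝ)
    (hv : ∀ y, ‖v y‖ ≤ m * Real.exp (-(κ * (Site.tdist (P := F.P K) (iterBlockOf (K - n) y) z : ℝ)))) :
    ∀ y : Site (F.P K) 0, ‖WL2.equiv ℂ _ W₂ (toL2S F K c₀ v) (siteEquiv F K y)‖
      ≤ (Real.sqrt 2 * m) * Real.exp (-(κ * (Site.tdist (P := F.P K) (iterBlockOf (K - n) y) z : ℝ))) := by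
  intro y
  rw [toL2S_apply, Equiv.symm_apply_apply]
  calc _ ≤ Real.sqrt 2 * ‖v y‖ := norm_frobEquiv_symm_le _
    _ ≤ Real.sqrt 2 * (m * Real.exp (-(κ * (Site.tdist (P := F.P K) (iterBlockOf (K - n) y) z : ℝ)))) := mul_le_mul_of_nonneg_left (hv y) (Real.sqrt_nonneg _)
    _ = _ := by ring

omit [Fact (0 < c₀)] [Fact (0 < c₁)] [Fact (0 < cB)] in
/-- A source SUPPORTED in the block `B(z)` with `‖v y‖ ≤ m` (`0 ≤ m`) is a weighted source about `z` at every rate: `‖v y‖ ≤ m·E_z(y)` (`tdist(z, z) = 0`). [folklore] -/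
theorem weighted_of_blockSupported_source (v : Site (F.P K) 0 → Matrix (Fin 2) (Fin 2) ℂ) (z : Site (F.P K) (K - n))
    (hvz : ∀ y, v y ≠ 0 → iterBlockOf (K - n) y = z) (m : ℝ) (hm : 0 ≤ m) (hv : ∀ y, ‖v y‖ ≤ m) :
    ∀ y, ‖v y‖ ≤ m * Real.exp (-(κ * (Site.tdist (P := F.P K) (iterBlockOf (K - n) y) z : ℝ))) := by
  intro y
  by_cases hy : v y = 0
  · rw [hy, norm_zero]; positivity
  · rw [hvz y hy, B3Taylor310LocalRemainder.tdist_self, Nat.cast_zero, mul_zero, neg_zero, Real.exp_zero, mul_one]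
    exact hv y

include hseq hGA hRS hker hGw hPw in
omit [Fact (0 < c₁)] in
/-- ★★★ **(c1w) — D2's WEIGHTED LETTER `hc1w` BY TEXT**: `‖v y‖ ≤ m·e^{−κ·tdist(B y, z)}` ⟹ `‖(toL2S⁻¹(G′ᴾ_{a′}(R_S(toL2S v))))(y)‖ ≤ (√2·B_w(1+P_w))·m·e^{−κ·tdist(B y, z)}`.
[cite: Balaban1985BackgroundPropagators, (3.25) p.394, Thm 3.1 (3.42)∕(3.46) pp.397–398, (3.118)–(3.122) pp.419–420] -/
theorem hc1w_of_letters {a' : ℝ} (ha' : 0 ≤ a') :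
    ∀ (z : Site (F.P K) (K - n)) (v : Site (F.P K) 0 → Matrix (Fin 2) (Fin 2) ℂ) (m : ℝ), 0 ≤ m →
      (∀ y, ‖v y‖ ≤ m * Real.exp (-(κ * (Site.tdist (iterBlockOf (K - n) y) z : ℝ)))) →
      ∀ y, ‖(toL2S F K c₀).symm (GprimeP F n K h c₀ cB a' U₀ (RS F n K h c₀ cB U₀ (toL2S F K c₀ v))) y‖
        ≤ (Real.sqrt 2 * (Bw * (1 + Pw))) * m * Real.exp (-(κ * (Site.tdist (iterBlockOf (K - n) y) z : ℝ))) := by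
  intro z v m _ hv y
  rw [toL2S_symm_apply]
  refine (norm_frobEquiv_le _).trans ?_
  exact (norm_equiv_GprimeP_RS_le_of_weighted F h U₀ Q'' hseq ι T G hGA hRS hker hGw hPw ha' _ z _ (norm_equiv_toL2S_le_of_weighted F v z m hv) y).trans
    (le_of_eq (by ring))

include hseq hGA hRS hker hPw hDw in
omit [Fact (0 < c₁)] in
/-- ★★★ **(c2w) — D2's WEIGHTED LETTER `hc2w` BY TEXT**: `‖v y‖ ≤ m·e^{−κ·tdist(B y, z)}` ⟹ `‖(toL2⁻¹(D_{U₀}G′ᴾ_{a′}(R_S(toL2S v))))(b)‖ ≤ (√2·R_w(1+P_w))·m·e^{−κ·tdist(B b₋, z)}`.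
[cite: Balaban1985BackgroundPropagators, (3.25) p.394, Thm 3.1 (3.42) p.397; Balaban1985Variational, (139) p.299] -/
theorem hc2w_of_letters {a' : ℝ} (ha' : 0 ≤ a') :
    ∀ (z : Site (F.P K) (K - n)) (v : Site (F.P K) 0 → Matrix (Fin 2) (Fin 2) ℂ) (m : ℝ), 0 ≤ m →
      (∀ y, ‖v y‖ ≤ m * Real.exp (-(κ * (Site.tdist (iterBlockOf (K - n) y) z : ℝ)))) →
      ∀ b, ‖(toL2 F K c₀).symm (DL2 F n K c₀ U₀ (GprimeP F n K h c₀ cB a' U₀ (RS F n K h c₀ cB U₀ (toL2S F K c₀ v)))) b‖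
        ≤ (Real.sqrt 2 * (Rw * (1 + Pw))) * m * Real.exp (-(κ * (Site.tdist (iterBlockOf (K - n) b.src) z : ℝ))) := by
  intro z v m _ hv b
  rw [toL2_symm_apply]
  refine (norm_frobEquiv_le _).trans ?_
  exact (norm_equiv_DL2_GprimeP_RS_le_of_weighted F h U₀ Q'' hseq ι T G hGA hRS hker hPw hDw ha' _ z _ (norm_equiv_toL2S_le_of_weighted F v z m hv) b).trans
    (le_of_eq (by ring))

include hseq hT hAG hGA hRS hker hGw hPw in
/-- ★★★ **(c3w) — D2's WEIGHTED LETTER `hc3w` BY TEXT**: `‖v y‖ ≤ m·e^{−κ·tdist(B y, z)}` ⟹ `‖(toL2S⁻¹(R_S(G′ᴾ_{a′}(toL2S v))))(y)‖ ≤ (√2·B_w(1+P_w))·m·e^{−κ·tdist(B y, z)}`.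
[cite: Balaban1985BackgroundPropagators, (3.21)–(3.25) p.394, Thm 3.1 (3.42)∕(3.46) pp.397–398] -/
theorem hc3w_of_letters {a' : ℝ} (ha' : 0 ≤ a') :
    ∀ (z : Site (F.P K) (K - n)) (v : Site (F.P K) 0 → Matrix (Fin 2) (Fin 2) ℂ) (m : ℝ), 0 ≤ m →
      (∀ y, ‖v y‖ ≤ m * Real.exp (-(κ * (Site.tdist (iterBlockOf (K - n) y) z : ℝ)))) →
      ∀ y, ‖(toL2S F K c₀).symm (RS F n K h c₀ cB U₀ (GprimeP F n K h c₀ cB a' U₀ (toL2S F K c₀ v))) y‖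
        ≤ (Real.sqrt 2 * (Bw * (1 + Pw))) * m * Real.exp (-(κ * (Site.tdist (iterBlockOf (K - n) y) z : ℝ))) := by
  intro z v m _ hv y
  rw [toL2S_symm_apply]
  refine (norm_frobEquiv_le _).trans ?_
  exact (norm_equiv_RS_GprimeP_le_of_weighted F h U₀ Q'' hseq ι T hT G hAG hGA hRS hker hGw hPw ha' _ z _ (norm_equiv_toL2S_le_of_weighted F v z m hv) y).trans
    (le_of_eq (by ring))

include hseq hGA hRS hker hGw hPw in
omit [Fact (0 < c₁)] in
/-- ★★★ **(c1b) — D3's BLOCK-SUPPORTED LETTER `hc1b` BY TEXT** (✓`hGblk_pi_of_blockLetters`' binder, `δ₁ := κ`, `C₁ := √2·B_w(1+P_w)`): for `v` supported in `B(z)` with `‖v y‖ ≤ m`,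
`‖(toL2S⁻¹(G′ᴾ_{a′}(R_S(toL2S v))))(y)‖ ≤ m·C₁·e^{−κ·tdist(B y, z)}`. [cite: Balaban1985BackgroundPropagators, (3.25) p.394, Thm 3.1 (3.42)∕(3.46) pp.397–398, (3.49) p.399] -/
theorem hc1b_of_letters {a' : ℝ} (ha' : 0 ≤ a') :
    ∀ (v : Site (F.P K) 0 → Matrix (Fin 2) (Fin 2) ℂ) (z : Site (F.P K) (K - n)), (∀ y, v y ≠ 0 → iterBlockOf (K - n) y = z) →
      ∀ m : ℝ, 0 ≤ m → (∀ y, ‖v y‖ ≤ m) →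
        ∀ y : Site (F.P K) 0, ‖(toL2S F K c₀).symm (GprimeP F n K h c₀ cB a' U₀ (RS F n K h c₀ cB U₀ (toL2S F K c₀ v))) y‖
          ≤ m * (Real.sqrt 2 * (Bw * (1 + Pw))) * Real.exp (-(κ * (Site.tdist (P := F.P K) (iterBlockOf (K - n) y) z : ℝ))) := by
  intro v z hvz m hm hv y
  exact (hc1w_of_letters F h U₀ Q'' hseq ι T G hGA hRS hker hGw hPw ha' z v m hm (weighted_of_blockSupported_source F v z hvz m hm hv) y).trans
    (le_of_eq (by ring))

include hseq hGA hRS hker hPw hDw in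
omit [Fact (0 < c₁)] in
/-- ★★★ **(c2b) — D3's BLOCK-SUPPORTED LETTER `hc2b` BY TEXT** (`δ₁ := κ`, `C₂ := √2·R_w(1+P_w)`): for `v` supported in `B(z)` with `‖v y‖ ≤ m`,
`‖(toL2⁻¹(D_{U₀}G′ᴾ_{a′}(R_S(toL2S v))))(b)‖ ≤ m·C₂·e^{−κ·tdist(B b₋, z)}`. [cite: Balaban1985BackgroundPropagators, (3.25) p.394, Thm 3.1 (3.42) p.397, (3.49) p.399] -/
theorem hc2b_of_letters {a' : ℝ} (ha' : 0 ≤ a') :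
    ∀ (v : Site (F.P K) 0 → Matrix (Fin 2) (Fin 2) ℂ) (z : Site (F.P K) (K - n)), (∀ y, v y ≠ 0 → iterBlockOf (K - n) y = z) →
      ∀ m : ℝ, 0 ≤ m → (∀ y, ‖v y‖ ≤ m) →
        ∀ b : PBond (F.P K) 0, ‖(toL2 F K c₀).symm (DL2 F n K c₀ U₀ (GprimeP F n K h c₀ cB a' U₀ (RS F n K h c₀ cB U₀ (toL2S F K c₀ v)))) b‖
          ≤ m * (Real.sqrt 2 * (Rw * (1 + Pw))) * Real.exp (-(κ * (Site.tdist (P := F.P K) (iterBlockOf (K - n) b.src) z : ℝ))) := by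
  intro v z hvz m hm hv b
  exact (hc2w_of_letters F h U₀ Q'' hseq ι T G hGA hRS hker hPw hDw ha' z v m hm (weighted_of_blockSupported_source F v z hvz m hm hv) b).trans
    (le_of_eq (by ring))

include hseq hT hAG hGA hRS hker hGw hPw in
/-- ★★★ **(c3b) — D3's BLOCK-SUPPORTED LETTER `hc3b` BY TEXT** (`δ₁ := κ`, `C₃ := √2·B_w(1+P_w)`): for `v` supported in `B(z)` with `‖v y‖ ≤ m`,
`‖(toL2S⁻¹(R_S(G′ᴾ_{a′}(toL2S v))))(y)‖ ≤ m·C₃·e^{−κ·tdist(B y, z)}`. [cite: Balaban1985BackgroundPropagators, (3.21)–(3.25) p.394, Thm 3.1 (3.42)∕(3.46) pp.397–398, (3.49) p.399] -/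
theorem hc3b_of_letters {a' : ℝ} (ha' : 0 ≤ a') :
    ∀ (v : Site (F.P K) 0 → Matrix (Fin 2) (Fin 2) ℂ) (z : Site (F.P K) (K - n)), (∀ y, v y ≠ 0 → iterBlockOf (K - n) y = z) →
      ∀ m : ℝ, 0 ≤ m → (∀ y, ‖v y‖ ≤ m) →
        ∀ y : Site (F.P K) 0, ‖(toL2S F K c₀).symm (RS F n K h c₀ cB U₀ (GprimeP F n K h c₀ cB a' U₀ (toL2S F K c₀ v))) y‖
          ≤ m * (Real.sqrt 2 * (Bw * (1 + Pw))) * Real.exp (-(κ * (Site.tdist (P := F.P K) (iterBlockOf (K - n) y) z : ℝ))) := by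
  intro v z hvz m hm hv y
  exact (hc3w_of_letters F h U₀ Q'' hseq ι T hT G hAG hGA hRS hker hGw hPw ha' z v m hm (weighted_of_blockSupported_source F v z hvz m hm hv) y).trans
    (le_of_eq (by ring))

/-! ## §3 Suppliers of the P-letter and of the gradient letter -/

omit [Fact (0 < c₁)] [Fact (0 < cB)] in
/-- ★★ **THE P-LETTER `hPw` FROM V5b's SPIKE KERNEL LETTER** (displayed as `hPker` in V5b's conclusion shape; inhabited by ✓`norm_equiv_sub_projR_single_le_closed`): for every
`0 ≤ κ < μ′`, `‖f(x)‖ ≤ F_b·E_z(x)` ⟹ `‖((1 − projR Δ_{U₀} Q″) f)(x)‖ ≤ C_P·(L^d)^{K−n}·(2(1+1∕(μ′−κ)))³·F_b·E_z(x)` — (W2) ✓`blockLetter_of_spikeKernel` then (W1) ✓`norm_equiv_apply_le_of_blockLetter`.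
[cite: Balaban1985BackgroundPropagators, (3.21)–(3.25) p.394, (3.49) p.399] -/
theorem hPw_of_spikeKernel {CP μ' κ' : ℝ} (hCP : 0 ≤ CP) (hκ' : 0 ≤ κ') (hκμ : κ' < μ')
    (hPker : ∀ (x' : Site (F.P K) 0) (X' : Matrix (Fin 2) (Fin 2) ℂ) (x : Site (F.P K) 0),
      ‖WL2.equiv ℂ _ W₂ (toL2S F K c₀ (Pi.single x' X') - projR (covLapSite F n K c₀ U₀) Q'' (toL2S F K c₀ (Pi.single x' X'))) (siteEquiv F K x)‖
        ≤ CP * Real.exp (-(μ' * (Site.tdist (P := F.P K) (iterBlockOf (K - n) x) (iterBlockOf (K - n) x') : ℝ))) * ‖(frobEquiv.symm X' : W₂)‖) :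
    ∀ (f : SiteL2K ℂ 3 (periodsT3 F K) c₀ W₂) (z : Site (F.P K) (K - n)) (Fb : ℝ),
      (∀ x : Site (F.P K) 0, ‖WL2.equiv ℂ _ W₂ f (siteEquiv F K x)‖ ≤ Fb * Real.exp (-(κ' * (Site.tdist (P := F.P K) (iterBlockOf (K - n) x) z : ℝ)))) →
      ∀ x : Site (F.P K) 0, ‖WL2.equiv ℂ _ W₂ ((LinearMap.id - projR (covLapSite F n K c₀ U₀) Q'' : SiteL2K ℂ 3 (periodsT3 F K) c₀ W₂ →ₗ[ℂ] SiteL2K ℂ 3 (periodsT3 F K) c₀ W₂) f) (siteEquiv F K x)‖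
        ≤ CP * ((((F.P K).L : ℝ) ^ (F.P K).d) ^ (K - n)) * (2 * (1 + 1 / (μ' - κ'))) ^ 3 * Fb * Real.exp (-(κ' * (Site.tdist (P := F.P K) (iterBlockOf (K - n) x) z : ℝ))) := by
  intro f z Fb hf x
  have hblk := blockLetter_of_spikeKernel F (LinearMap.id - projR (covLapSite F n K c₀ U₀) Q'') (CP := CP) (μ' := μ')
    (fun x' X' x => by rw [LinearMap.sub_apply, LinearMap.id_apply]; exact hPker x' X' x) hCP
  exact norm_equiv_apply_le_of_blockLetter F (LinearMap.id - projR (covLapSite F n K c₀ U₀) Q'') (by positivity) hκ' hκμ hblk f z hf x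

include hAG hGw in
omit [Fact (0 < c₁)] [Fact (0 < cB)] in
/-- ★★ **THE GRADIENT LETTER `hDw` FROM THE VALUE AND PENALTY LETTERS** — px21 ✓`gradient_decay_of_decay` (T1-κ for a general `(u, q)`) at `u := G_a f`, `q := a·T(ι(Q″(G_a f))) − f`
(`Δ^η_{U₀}u + q = D*_{U₀}0` by `hAG`), weighted value letter `hGw` (`B_w`) and penalty letter `hpen` (`P_pen`, ⟸ (W1) ✓`hpenW_of_regPr`), under `RegPr`, the room and the margin:
`‖f(x)‖ ≤ F_b·E_z(x)` ⟹ `‖(D_{U₀}(G_a f))(b)‖ ≤ R_w·F_b·E_z(b₋)`, `R_w = 2·(C_g·(B_w e^{51κ}·c(ε₀) + (P_pen + 1)e^{51κ}) + 2√2·48ε₀·B_w e^{51κ})`.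
[cite: Balaban1985BackgroundPropagators, Thm 3.1 (3.42)–(3.44) pp.397–398, (3.139) p.425] -/
theorem hDw_of_letters {ε₀ : ℝ} (hε₀ : 0 < ε₀) (hε1 : ε₀ ≤ 1) (hreg : RegPr F n K ε₀ U₀) (hκ : 0 ≤ κ) (hBw : 0 ≤ Bw) {Ppen : ℝ} (hPpen : 0 ≤ Ppen)
    (hpen : ∀ (f : SiteL2K ℂ 3 (periodsT3 F K) c₀ W₂) (z : Site (F.P K) (K - n)) (Fb : ℝ),
      (∀ x : Site (F.P K) 0, ‖WL2.equiv ℂ _ W₂ f (siteEquiv F K x)‖ ≤ Fb * Real.exp (-(κ * (Site.tdist (P := F.P K) (iterBlockOf (K - n) x) z : ℝ)))) →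
      ∀ x : Site (F.P K) 0, ‖WL2.equiv ℂ _ W₂ ((a : ℂ) • T (ι (Q'' (G f)))) (siteEquiv F K x)‖ ≤ Ppen * Fb * Real.exp (-(κ * (Site.tdist (P := F.P K) (iterBlockOf (K - n) x) z : ℝ))))
    (hroom : 2 * (12 * F.L ^ (K - n) + 5) ≤ (F.P K).sitesPerDir 0)
    (hsmall : exists_curved_localGradient.choose * ((48 * ε₀) * (6 * Real.sqrt 2 * Real.sqrt 10 + 6 * Real.sqrt 2)) * Real.exp (51 * κ) ≤ 1 / 2) :
    ∀ (f : SiteL2K ℂ 3 (periodsT3 F K) c₀ W₂) (z : Site (F.P K) (K - n)) (Fb : ℝ),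
      (∀ x : Site (F.P K) 0, ‖WL2.equiv ℂ _ W₂ f (siteEquiv F K x)‖ ≤ Fb * Real.exp (-(κ * (Site.tdist (P := F.P K) (iterBlockOf (K - n) x) z : ℝ)))) →
      ∀ b : PBond (F.P K) 0, ‖WL2.equiv ℂ _ W₂ (DL2 F n K c₀ U₀ (G f)) (bondEquiv F K b)‖
        ≤ (2 * ((exists_curved_localGradient.choose *
            ((Bw * Real.exp (51 * κ)) * (2 + 2 * Real.sqrt 2 * (4 * ε₀ * (3 + 2457 * norm_bgOfCfg_axialT_sub_le.choose)) + (24 * Real.sqrt 10 + 48) * (48 * ε₀) ^ 2)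
              + (Ppen + 1) * Real.exp (51 * κ))
          + 2 * Real.sqrt 2 * (48 * ε₀) * (Bw * Real.exp (51 * κ)))))
          * Fb * Real.exp (-(κ * (Site.tdist (P := F.P K) (iterBlockOf (K - n) b.src) z : ℝ))) := by
  intro f z Fb hf b
  have hFb0 : 0 ≤ Fb := (mul_nonneg_iff_of_pos_right (Real.exp_pos _)).mp ((norm_nonneg _).trans (hf b.src))
  -- the massive equation as `Δ^η_{U₀}(G f) + q = D*_{U₀} 0`, `q := a•T(ι(Q″(G f))) − f`
  have hueq : covLapSite F n K c₀ U₀ (G f) + ((a : ℂ) • T (ι (Q'' (G f))) - f) = DstarL2 F n K c₀ U₀ 0 := by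
    rw [← add_sub_assoc, hAG f, sub_self, map_zero]
  have hq : ∀ x' : Site (F.P K) 0, ‖WL2.equiv ℂ (fun _ : TSite 3 (periodsT3 F K) => c₀) W₂ ((a : ℂ) • T (ι (Q'' (G f))) - f) (siteEquiv F K x')‖
      ≤ (Ppen + 1) * Fb * Real.exp (-(κ * (Site.tdist (P := F.P K) (iterBlockOf (K - n) x') z : ℝ))) := by
    intro x'
    rw [WL2.equiv_sub, Pi.sub_apply]
    calc _ ≤ Ppen * Fb * Real.exp (-(κ * (Site.tdist (P := F.P K) (iterBlockOf (K - n) x') z : ℝ)))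
          + Fb * Real.exp (-(κ * (Site.tdist (P := F.P K) (iterBlockOf (K - n) x') z : ℝ))) :=
          (norm_sub_le _ _).trans (add_le_add (hpen f z Fb hf x') (hf x'))
      _ = _ := by ring
  have h2 := gradient_decay_of_decay F n K hε₀ hε1 U₀ hreg c₀ (G f) _ hueq z (Au := Bw * Fb) (Aq := (Ppen + 1) * Fb) hκ
    (by positivity) (by positivity) (fun x' => hGw f z Fb hf x') hq hroom hsmall b
  refine h2.trans (le_of_eq ?_)
  ring

end Summit.QuantumFields.YangMills.Theorems.Prop7GaugeProjectorBlockPackage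

end
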